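import Summits.BirchSwinnertonDyer.BirchSwinnertonDyer.Theorems.QuadraticBranchSignedControlNoFiniteSubmoduleOfKO13Eta
import Summits.BirchSwinnertonDyer.BirchSwinnertonDyer.Theorems.InertBadSignedBranchesNoFiniteSubmoduleOfTower
import HarnessLib

/-!
# Route `QuadraticBranchSignedControl` (rung K8, cell `bsd-potss`): the crux (R2±)
# `NoFiniteSubmoduleSigned` (stmt-BirchSwinnertonDyer-19117) and BOTH sign items (19222 / 19233) from
# the two PRINT-VERBATIM named facts on the WHOLE dual `X^±(E/ℚ(μ_{p^∞}))` —
# `KitajimaOtsuki2018.mainThm13_towerSignedSelmerDual_noFiniteSubmodule` (Kitajima–Otsuki 2018 Main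
# Thm. 1.3, `F = ℚ`, both signs) and `Kobayashi2003.thm22_towerSignedSelmerDual_finite_torsion`
# (Kobayashi 2003 Thm. 2.2) — the reading flag `KO18-eta-summand` GONE from the dependency chain

HONEST FRAMING (cell `bsd-potss`, run/shared/lean/pub/bsd-potss/; FULL-BSD rank ≤ 1 programme,
tranche 1b): CONDITIONAL RESULTS on exactly TWO named Literature facts (published theorems, unproved
in the tree; `conditional-result`s), no reading frame, no side hypothesis, no definition, no `sorry`,
axioms standard. The two facts (cell bsd-cm, seat `bsd-cm-k8i-ty`, 2026-08-26 ≈07:16Z, on the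
Literature-homed WHOLE-dual datum `Kobayashi2003.TowerSignedSelmerDualData` — field for field this
seat's Summits-side `Additive.TowerSignedSelmerDualData`, p418977) are the printed statements: "both
`Sel^±(F_∞, E[p^∞])^∨` have no nontrivial finite `Λ`-submodule" (Kitajima–Otsuki, WHOLE dual,
`Λ = ℤ_p[[Gal(F_∞/F_0)]]`, with its hypothesis (vi) displayed) and "`X^±(E/K_∞)` is a finitely
generated torsion `Λ`-module" (Kobayashi Thm. 2.2 = hypothesis (vi) for `F = ℚ`). The passage to the
`η`-components — the former reading flag `KO18-eta-summand` — is the tree THEOREM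
`TowerReadingsOfLiterature.mainThm13_eta_of_tower` (bsd-cm, 09:19Z), whose mathematical content is this
seat's `Additive.EtaSignedSelmerDualData.forall_finite_eq_bot_of_tower` (the `Λ`-linear injection
`X^{±,η} ↪ X^±` dual to the `η`-average, p418977); the rest is this seat's p420378
(`…_of_mainThm13Eta`). The items are NOT closed by this file (the facts are hypotheses); it records
that the K8 (R2±) nodes follow from two VERBATIM published theorems with every intermediate step
kernel-checked. BSD is not proved by any of this.

References: [KitajimaOtsuki2018] Main Thm. 1.3 (= Thm. 4.8), Def. 2.1, Remark 1.4 (5), §4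
(arXiv:1607.03612 pp. 3, 4, 6, 18); [Kobayashi2003] §2 p. 4, Def. 2.1 and Thm. 2.2 (p. 5), §3 p. 5,
§4 p. 8.
-/

set_option autoImplicit false
set_option linter.dupNamespace false

noncomputable section

namespace Summit.BirchSwinnertonDyer.BirchSwinnertonDyer.Theorems

open Summit.BirchSwinnertonDyer.BirchSwinnertonDyer.Theses.QuadraticBranchSignedControl

/-- **(R2⁺) `NoFiniteSubmodulePlus` (item stmt-BirchSwinnertonDyer-19222) from Kitajima–Otsuki Main
Thm. 1.3 and Kobayashi Thm. 2.2, both as named facts on the WHOLE dual `X⁺(V/ℚ(μ_{p^∞}))`** — no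
reading flag: `η`-descent by `TowerReadingsOfLiterature.mainThm13_eta_of_tower`, then
`noFiniteSubmodulePlus_of_mainThm13Eta`. CONDITIONAL on the two facts; closes nothing by itself.
[cite: KitajimaOtsuki2018, Main Thm. 1.3 (= Thm. 4.8) with Def. 2.1 (arXiv:1607.03612 pp. 3, 6)]
[cite: Kobayashi2003, Thm. 2.2 (p. 5), §4 p. 8] -/
theorem noFiniteSubmodulePlus_of_mainThm13Tower
    (h13 : Literature.NumberTheory.EllipticCurves.KitajimaOtsuki2018.mainThm13_towerSignedSelmerDual_noFiniteSubmodule)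
    (h22 : Literature.NumberTheory.EllipticCurves.Kobayashi2003.thm22_towerSignedSelmerDual_finite_torsion) :
    NoFiniteSubmodulePlus :=
  noFiniteSubmodulePlus_of_mainThm13Eta (TowerReadingsOfLiterature.mainThm13_eta_of_tower h13 h22)

/-- **(R2⁻) `NoFiniteSubmoduleMinus` (item stmt-BirchSwinnertonDyer-19233) from the same two named
facts on the WHOLE dual `X⁻(V/ℚ(μ_{p^∞}))`** (Kobayashi's §2 minus object WITH the `m = −1` clause =
Kitajima–Otsuki's Def. 2.1 for `F = ℚ`). CONDITIONAL on the two facts; closes nothing by itself.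
[cite: KitajimaOtsuki2018, Main Thm. 1.3 (= Thm. 4.8) with Def. 2.1 (arXiv:1607.03612 pp. 3, 6)]
[cite: Kobayashi2003, §2 p. 4 (the m = −1 clause), Thm. 2.2 (p. 5)] -/
theorem noFiniteSubmoduleMinus_of_mainThm13Tower
    (h13 : Literature.NumberTheory.EllipticCurves.KitajimaOtsuki2018.mainThm13_towerSignedSelmerDual_noFiniteSubmodule)
    (h22 : Literature.NumberTheory.EllipticCurves.Kobayashi2003.thm22_towerSignedSelmerDual_finite_torsion) :
    NoFiniteSubmoduleMinus :=
  noFiniteSubmoduleMinus_of_mainThm13Eta (TowerReadingsOfLiterature.mainThm13_eta_of_tower h13 h22)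

/-- **(R2±) the K8 node `NoFiniteSubmoduleSigned` (item stmt-BirchSwinnertonDyer-19117) from the two
print-verbatim named facts on the WHOLE duals** (both signs). CONDITIONAL on the two facts — the node
is Kitajima–Otsuki 2018 Main Thm. 1.3 + Kobayashi 2003 Thm. 2.2 (`F = ℚ`) and nothing more; closes
nothing by itself. [cite: KitajimaOtsuki2018, Main Thm. 1.3 (= Thm. 4.8) (arXiv:1607.03612 p. 3)]
[cite: Kobayashi2003, Thm. 2.2 (p. 5)] -/
theorem noFiniteSubmoduleSigned_of_mainThm13Tower
    (h13 : Literature.NumberTheory.EllipticCurves.KitajimaOtsuki2018.mainThm13_towerSignedSelmerDual_noFiniteSubmodule)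
    (h22 : Literature.NumberTheory.EllipticCurves.Kobayashi2003.thm22_towerSignedSelmerDual_finite_torsion) :
    NoFiniteSubmoduleSigned :=
  noFiniteSubmoduleSigned_of_mainThm13Eta (TowerReadingsOfLiterature.mainThm13_eta_of_tower h13 h22)

end Summit.BirchSwinnertonDyer.BirchSwinnertonDyer.Theorems

end
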